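import Summits.Ventures.AbcSig.Rows.BridgeC2c
import Summits.Ventures.AbcSig.Rows.C2cL43
import Summits.Ventures.AbcSig.Levels.N11008M4C17K7
import Summits.Ventures.AbcSig.Levels.N11008M4C17K8

/-!
# Venture AbcSig — CELL `C2cL43`: p1's census predicate `Rows.C2cCell 43 {11}` from the C2c row (exponent reduction by `Rows/BridgeC2c.lean`)

K-VARIANT (p-lean g7 `gen7/kpatch.py`): the CITED module-M4 hypotheses for the pairs 11008.7 @ 17, 11008.8 @ 17 (tree orbit indices) are replaced by the KERNEL class-by-class
Kraus discharges of `Levels/N…M4C….lean` (`gen7/m4cgen.py`: class tables = `Recipes/KrausTable.lean` values = the census certificates' `S_q_mod_n`; mod-n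
certificates by `decide +kernel`) under the COMPUTED same-newforms hypotheses `hM_…` and the named hypotheses `hK_…` (`RefinedTraces` per reduced exponent,
CITED recipe [BS04 p. 27 + (3.1), Kra97] + COMPUTED table). Every other hypothesis and the conclusion are those of `Rows/C2cL43Cell.lean` verbatim (cell proof copied; the rows of record are applied unchanged).
HONEST FRAMING. COMPUTATION cell `pub-abcsig`; CONDITIONAL theorem; no claim on ABC or any summit. Hypotheses exactly as in
`Rows/C2cL43.lean`: `BS04Package` (CITED), `DataComplete 11008` / `RefinesCPSymAll 11008` (COMPUTED; norm-form certificates), the row's per-orbit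
CITED exclusions universally quantified in `n` and `m`. Conclusion = the conjunct `Rows.C2cCell 43 {11}` of p1's `C2Part2Signed` /
`C2Part2bSigned` (`Rows/Statements.lean`; row of record `census/rows/C2a/C2c-l43.md`): ALL `m ≥ 1` with `n ∤ m` and all
coprime distributions `A·B = 43^m` — obtained from the reduced rows (`m < n`) by `C2cCell_of_rows` (m ↦ m mod n, y ↦ ℓ^q·y).
-/

namespace Summit.Ventures.AbcSig

/-- Cell `C2cL43`: `Rows.C2cCell 43 {11}` under the row's hypotheses. -/
theorem xcell_C2cL43K (M : NewformModel) (hP : M.BS04Package)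
    (hD11008 : M.DataComplete 11008 level11008Orbits) (hCP11008 : M.RefinesCPSymAll 11008 level11008CP)
    (hM_11008_7 : ∀ f : M.Form 11008, M.Matches f orbit_11008_7 → M.Matches f m4cX_11008_7_n17)
    (hK_11008_7 : ∀ m : ℕ, 1 ≤ m → m < 17 → M.RefinedTraces (famC2c 43 m 17) (m4cTab_a0C2c_11008_7_n17 m))
    (hM_11008_8 : ∀ f : M.Form 11008, M.Matches f orbit_11008_8 → M.Matches f m4cX_11008_8_n17)
    (hK_11008_8 : ∀ m : ℕ, 1 ≤ m → m < 17 → M.RefinedTraces (famC2c 43 m 17) (m4cTab_a0C2c_11008_8_n17 m)) :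
    Rows.C2cCell 43 {11} :=
  C2cCell_of_rows 43 (by norm_num) (by norm_num) _
    (fun n hn h11 hnℓ hR m hm hmn x y z h1 h2 =>
      xrow_C2cL43 M hP hD11008 hCP11008 n hn h11 hnℓ (by intro hmem; simp only [List.mem_cons, List.not_mem_nil, or_false] at hmem; subst hmem; simp at hR) m hm hmn (fun hmem => by
      obtain rfl : n = 17 := by simpa using hmem
      exact orbit_11008_7_exclM4_a0C2c_17 M hM_11008_7 hK_11008_7 m hm hmn) (fun hmem => by
      obtain rfl : n = 17 := by simpa using hmem
      exact orbit_11008_8_exclM4_a0C2c_17 M hM_11008_8 hK_11008_8 m hm hmn) x y z h1 h2)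

end Summit.Ventures.AbcSig
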